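import Literature.NumberTheory.Transcendental.RoySmallValueEstimatesProp14Proofs
import Literature.NumberTheory.Transcendental.RoySmallValueEstimatesTranslatesGcdProofs
import Literature.NumberTheory.Transcendental.RoySmallValueLevels
import Literature.NumberTheory.Transcendental.RoySmallValueCycleHeights
import Literature.NumberTheory.Transcendental.RoySmallValuePhiLength
import HarnessLib

/-!
# Small value estimates at rational translates (Nguyen–Roy 2016) — proofs, XXIV: the arithmetic Bézout bound for `𝒵(P̃_D, Q)` (Proposition 14, arithmetic half)

Twenty-fourth proofs file towards `Literature.NumberTheory.Transcendental.nguyenRoy2016_thm_1` (Nguyen–Roy,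
IJNT 12 (2016) = arXiv:1412.5163). Everything here is PROVED; no named facts. The arithmetic half of
the proof of **Proposition 14** (§5):

> "… there exist integers `a₁, …, a_D` … such that `Q := ∑ aᵢΦⁱ(P)` is relatively prime to `P`.
> Then `W := 𝒵(P, Q)` has dimension `0`. So, it is a finite union of `ℚ`-subvarieties of `ℙ²(ℂ)`
> whose sum of the degrees is `deg(W) ≤ D²` and whose sum of the heights is
> `h(W) ≤ D log‖P‖ + D log‖Q‖ + O(D²)` … this gives `h(W) ≤ 5D^{1+β}`."

delivered as the input `ZeroBounds` of file XXII. The paper reads these bounds off the resultant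
`Res_{(D,D,1)}`; the tree formalises Roy's [R2012] without Chow forms (seat-B files
`RoySmallValue*`), and we follow that route: with `Q` the companion
`∑_{i=1}^D tⁱ Φⁱ P̃_D` coprime to `P̃_D` (Lemma 13, tree
`NguyenRoy.exists_coprime_tau_combination_rat`), the determinant `Φ(P̃, Q, ·)` of the proof of
[R2012, Thm. 5.2] factors as `c ∏ⱼ ℓ_{αⱼ}^{eⱼ}` over representatives `αⱼ` of ALL common zeros,
`∑ eⱼ = D²` (`Roy2013.royF_eq_C_mul_prod`, `Roy2013.exists_common_zero_reprs`), and the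
Gelfond–Mahler inequality for the integer polynomial `Φ(P̃, Q₀, ·)` gives
`∑ⱼ eⱼ D h(αⱼ) ≤ log 𝓛(Φ(P̃, Q₀, ·))` (`Roy2013.sum_mul_height_le_log_length_royF`), while
`𝓛(Φ) ≤ N! ‖P̃‖^{N₀} ‖Q‖^{N₁}` (`Roy2013.l1Norm_royF_le`) with `log ‖P̃‖, log ‖Q‖ = O(D^β)`:

* `TauPkg`, `nonempty_tauPkg` — the data (monomial complements, representatives of the common
  zeros, factorisation) for a pair of coprime integer forms, exactly as the seat-B record
  `Roy2013.LevelPkg` but for an arbitrary companion `Q₀` (theirs is the `𝒟`-companion);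
* `exists_int_companion` — the integer model `Q₀` of `Q = ∑ tⁱΦⁱP̃_D` with its coprimality and size;
* `TauPkg.sum_mul_habs_le` — `∑ⱼ eⱼ h_abs(αⱼ) ≤ log 𝓛(Φ(P̃, Q₀, ·)) / D`;
* **`zeroBounds_of_propsAt`** — `ZeroBounds r s β Pt 800 D` for `D ≥ 1` (`β ≥ 2`), and
  **`exists_zeroBounds`** — the hypothesis `bezout` of `nguyenRoy2016_thm_1_of_zeroBounds_cor16`.

## References

* [NguyenRoy2016] N. A. V. Nguyen, D. Roy, IJNT 12 (2016) 1273–1293 = arXiv:1412.5163, §5,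
  proof of Proposition 14 (`deg W ≤ D²`, `h(W) ≤ 5D^{1+β}`).
* [Roy2013] D. Roy, Mathematika 59 (2013), §6, proof of Prop. 6.4 (the model of the argument).
-/

noncomputable section

open Height Module Finset MvPolynomial
open Literature.NumberTheory.Transcendental.Nesterenko
open Literature.NumberTheory.Transcendental.Roy2013 (CX royF evalForm PhiCol PhiRow closureField
  mem_closureField lineForm exists_phi_data card_eq_sq exists_common_zero_reprs exists_normalised
  eval_smul_eq_zero_iff exists_regular_lineForm_pow isHomogeneous_lineForm' royF_eq_C_mul_prod
  sum_mul_height_le_log_length_royF l1Norm_royF_le l1Norm_map_intCast toCX_map_int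
  isHomogeneous_map_rat royF_int_ne_zero map_royF isAlgebraic_ratio_of_common_zero)
open scoped Classical

namespace Literature.NumberTheory.Transcendental

namespace NguyenRoy

/-! ### The package of a pair of coprime integer forms -/

/-- The data attached to a pair of coprime integer forms `P̃, Q₀` of degree `D`: the data of `Φ`,
the (normalised) representatives of `𝒵(P̃, Q₀)` and the factorisation of `Φ(P̃, Q₀, ·)` — the
seat-B record `Roy2013.LevelPkg` with an arbitrary companion `Q₀`. (A record; nothing is asserted.)
[cite: Roy2013, §6, proof of Prop. 6.4; NguyenRoy2016, §5, proof of Prop. 14] -/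
structure TauPkg (D : ℕ) (Pt Q₀ : MvPolynomial (Fin 3) ℤ) where
  /-- monomial complements -/
  M₁ : Finset (Fin 3 →₀ ℕ)
  /-- monomial complements -/
  M₂ : Finset (Fin 3 →₀ ℕ)
  /-- columns ↔ rows -/
  σ : PhiCol D M₁ M₂ ≃ PhiRow D
  /-- number of points of `𝒵(P̃, Q₀)` -/
  m : ℕ
  /-- representatives (normalised: first non-zero coordinate `1`) -/
  α : Fin m → Fin 3 → ℂ
  /-- pivots -/
  piv : Fin m → Fin 3
  /-- leading constant of `F` -/
  c : ℂ
  /-- multiplicities -/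
  e : Fin m → ℕ
  hM₁ : ∀ μ ∈ M₁, μ.degree = 2 * D
  hM₂ : ∀ μ ∈ M₂, μ.degree = 2 * D
  hcard : M₂.card = D ^ 2
  hm : m ≤ D ^ 2
  hα0 : ∀ i, α i ≠ 0
  piv_one : ∀ i, α i (piv i) = 1
  piv_min : ∀ i k, α i k ≠ 0 → piv i ≤ k
  zero : ∀ i, eval (α i) (map (Int.castRingHom ℂ) Pt) = 0 ∧
    eval (α i) (map (Int.castRingHom ℂ) Q₀) = 0
  cov : ∀ β : Fin 3 → ℂ, β ≠ 0 → eval β (map (Int.castRingHom ℂ) Pt) = 0 →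
    eval β (map (Int.castRingHom ℂ) Q₀) = 0 → ∃ i, ∃ t : ℂ, β = t • α i
  sep : ∀ i j, i ≠ j → ¬∃ t : ℂ, α j = t • α i
  alg : ∀ i k, IsAlgebraic ℚ (α i k)
  hc : c ≠ 0
  he1 : ∀ i, 1 ≤ e i
  hesum : ∑ i, e i = M₂.card
  hFeq : royF D M₁ M₂ σ (map (Int.castRingHom ℂ) Pt) (map (Int.castRingHom ℂ) Q₀) =
    C c * ∏ i, evalForm D (α i) ^ e i
  hemax : ∀ i k, evalForm D (α i) ^ k ∣
    royF D M₁ M₂ σ (map (Int.castRingHom ℂ) Pt) (map (Int.castRingHom ℂ) Q₀) → k ≤ e i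

/-- **The package exists** for coprime integer forms of degree `D ≥ 1` (the generic part of the
seat-B proof of `Roy2013.nonempty_levelPkg`). [cite: Roy2013, §6, proof of Prop. 6.4] -/
theorem nonempty_tauPkg {D : ℕ} (hD : 1 ≤ D) {Pt Q₀ : MvPolynomial (Fin 3) ℤ}
    (hPt : (map (Int.castRingHom ℂ) Pt).IsHomogeneous D)
    (hQ : (map (Int.castRingHom ℂ) Q₀).IsHomogeneous D)
    (hPt0 : map (Int.castRingHom ℂ) Pt ≠ 0) (hQ0 : map (Int.castRingHom ℂ) Q₀ ≠ 0)
    (hPQ : ∀ f : CX, map (Int.castRingHom ℂ) Q₀ * f ∈ Ideal.span {map (Int.castRingHom ℂ) Pt} →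
      f ∈ Ideal.span {map (Int.castRingHom ℂ) Pt}) :
    Nonempty (TauPkg D Pt Q₀) := by
  classical
  set P : CX := map (Int.castRingHom ℂ) Pt with hPdef
  set Q : CX := map (Int.castRingHom ℂ) Q₀ with hQdef
  -- the data of `Φ`
  obtain ⟨a, b, hab, hreg⟩ := exists_regular_lineForm_pow hPt hQ hD hPt0 hQ0 hPQ
  have hR : (lineForm a b ^ D).IsHomogeneous D := by
    simpa using (isHomogeneous_lineForm' a b).pow D
  obtain ⟨M₁, M₂, hM₁, hM₂, hE₁i, hE₁s, hE₂i, hE₂s, ⟨σ⟩⟩ :=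
    exists_phi_data hPt hQ hR hPt0 hQ0 hPQ (hreg D)
  have hcard : M₂.card = D ^ 2 := card_eq_sq hPt hQ hPt0 hQ0 hPQ hE₂i hE₂s
  -- the representatives, normalised
  obtain ⟨m, α₀, hm, hα₀0, hz₀, hsep₀, hcov₀⟩ := exists_common_zero_reprs hPt hQ hPt0 hQ0 hPQ
  obtain ⟨α, piv, s, hs, hαs, hpiv1, hpivmin⟩ := exists_normalised α₀ hα₀0
  have hα0 : ∀ i, α i ≠ 0 := fun i h => by
    have := hpiv1 i; rw [h, Pi.zero_apply] at this; exact zero_ne_one this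
  have hz : ∀ i, eval (α i) P = 0 ∧ eval (α i) Q = 0 := fun i => by
    rw [hαs i, eval_smul_eq_zero_iff hPt (hs i), eval_smul_eq_zero_iff hQ (hs i)]
    exact hz₀ i
  have hsep : ∀ i j, i ≠ j → ¬∃ r : ℂ, α j = r • α i := by
    rintro i j hij ⟨r, hr⟩
    refine hsep₀ i j hij ⟨(s j)⁻¹ * r * s i, ?_⟩
    have h1 : α₀ j = (s j)⁻¹ • α j := by
      rw [hαs j, smul_smul, inv_mul_cancel₀ (hs j), one_smul]
    rw [h1, hr, hαs i, smul_smul, smul_smul]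
  have hcov : ∀ β : Fin 3 → ℂ, β ≠ 0 → eval β P = 0 → eval β Q = 0 → ∃ i, ∃ r : ℂ, β = r • α i := by
    intro β hβ hβP hβQ
    obtain ⟨i, r, hr⟩ := hcov₀ β hβ hβP hβQ
    refine ⟨i, r * (s i)⁻¹, ?_⟩
    rw [hr, hαs i, smul_smul, mul_assoc, inv_mul_cancel₀ (hs i), mul_one]
  -- algebraicity of the coordinates
  have halg : ∀ i k, IsAlgebraic ℚ (α i k) := by
    intro i k
    have hPq : (map (Int.castRingHom ℚ) Pt).IsHomogeneous D := isHomogeneous_map_rat hPt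
    have hQq : (map (Int.castRingHom ℚ) Q₀).IsHomogeneous D := isHomogeneous_map_rat hQ
    have h1 : α i k = α₀ i k / α₀ i (piv i) := by
      have hpk : α i (piv i) = 1 := hpiv1 i
      rw [hαs i] at hpk ⊢
      simp only [Pi.smul_apply, smul_eq_mul] at hpk ⊢
      have : s i = (α₀ i (piv i))⁻¹ := eq_inv_of_mul_eq_one_left hpk
      rw [this, inv_mul_eq_div]
    rw [h1]
    refine isAlgebraic_ratio_of_common_zero hPq hQq (by rw [toCX_map_int]; exact hPt0)
      (by rw [toCX_map_int]; exact hQ0) (by rw [toCX_map_int, toCX_map_int]; exact hPQ)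
      (by rw [toCX_map_int]; exact (hz₀ i).1) (by rw [toCX_map_int]; exact (hz₀ i).2) ?_ k
    intro h0
    have hpk : α i (piv i) = 1 := hpiv1 i
    rw [hαs i, Pi.smul_apply, smul_eq_mul, h0, mul_zero] at hpk
    exact zero_ne_one hpk
  -- the factorisation
  obtain ⟨c, e, hc, he1, hesum, hFeq, hemax⟩ := royF_eq_C_mul_prod hPt hQ hD hPt0 hQ0 hPQ hM₁ hM₂
    hE₁i hE₁s hE₂i hE₂s σ α hα0 hz hsep hcov
  exact ⟨⟨M₁, M₂, σ, m, α, piv, c, e, hM₁, hM₂, hcard, hm, hα0, hpiv1, hpivmin, hz, hcov, hsep, halg,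
    hc, he1, hesum, hFeq, hemax⟩⟩

/-! ### The integer companion `Q₀` of `Q = ∑ tⁱ Φⁱ P̃_D` -/

section companion

variable {ξ η : ℂ} {r s : ℚ} {σ₀ β ν : ℝ} {Pt : ℕ → MvPolynomial (Fin 3) ℤ}

/-- `Q_{D,t}` is a form of degree `D`. [folklore] -/
theorem isHomogeneous_Qcomb {D : ℕ} (hD : PropsAt ξ η r s σ₀ β ν Pt D) (t : ℕ) :
    (Qcomb r s Pt D t).IsHomogeneous D := by
  unfold Qcomb
  refine MvPolynomial.IsHomogeneous.sum _ _ _ fun j _ => ?_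
  rw [smul_eq_C_mul]
  exact (isHomogeneous_Fpoly hD j).C_mul _

/-- `Q_{D,t}` in the iterate form of the tree's `exists_coprime_tau_combination_rat`. [folklore] -/
theorem Qcomb_eq_sum_iterate (D t : ℕ) :
    Qcomb r s Pt D t =
      ∑ i ∈ Icc 1 D, ((t : ℂ) ^ i) • (Roy2013.tau (r : ℂ) (s : ℂ))^[i] (map (Int.castRingHom ℂ) (Pt D)) := by
  unfold Qcomb
  refine Finset.sum_congr rfl fun i _ => ?_
  rw [tau_iterate_eq, Fpoly]

/-- **The integer companion.** Under `PropsAt` at level `D ≥ 1` with `D < 4⌊D^σ⌋` (e.g. `σ ≥ 1`):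
an integer form `Q₀` of degree `D` with `Q₀ ⊗ ℂ = Q_{D,t}` and
`𝓛(Q_{D,t}) ≤ D · tᴰ · (D+1)² e^{2D^β}`. [cite: NguyenRoy2016, Prop. 4 and proof of Prop. 14] -/
theorem exists_int_companion {D : ℕ} (hD : PropsAt ξ η r s σ₀ β ν Pt D)
    (hD4 : D < 4 * ⌊(D : ℝ) ^ σ₀⌋₊) (t : ℕ) :
    ∃ Q₀ : MvPolynomial (Fin 3) ℤ, Q₀.IsHomogeneous D ∧
      map (Int.castRingHom ℂ) Q₀ = Qcomb r s Pt D t ∧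
      l1Norm (Qcomb r s Pt D t) ≤ D * (t : ℝ) ^ D * (((D : ℝ) + 1) ^ 2 * Real.exp (2 * (D : ℝ) ^ β)) := by
  have hex : ∀ i : ℕ, ∃ Qi : MvPolynomial (Fin 3) ℤ, i ≤ D → Qi.IsHomogeneous D ∧
      map (Int.castRingHom ℂ) Qi = Fpoly r s Pt D i ∧
      (mvPolyHeight Qi : ℝ) ≤ Real.exp (2 * (D : ℝ) ^ β) := by
    intro i
    by_cases hi : i ≤ D
    · obtain ⟨⟨Qi, h1, h2, h3⟩, -⟩ := hD.2.2 i (by omega)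
      exact ⟨Qi, fun _ => ⟨h1, h2, h3⟩⟩
    · exact ⟨0, fun h => absurd h hi⟩
  choose Qi hQi using hex
  refine ⟨∑ i ∈ Icc 1 D, ((t : ℤ) ^ i) • Qi i, ?_, ?_, ?_⟩
  · refine MvPolynomial.IsHomogeneous.sum _ _ _ fun i hi => ?_
    rw [smul_eq_C_mul]
    exact (hQi i (mem_Icc.mp hi).2).1.C_mul _
  · rw [map_sum, Qcomb]
    refine Finset.sum_congr rfl fun i hi => ?_
    rw [smul_eq_C_mul, map_mul, map_C, (hQi i (mem_Icc.mp hi).2).2.1, smul_eq_C_mul]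
    congr 1
    simp
  · unfold Qcomb
    have hterm : ∀ i ∈ Icc 1 D, l1Norm (((t : ℂ) ^ i) • Fpoly r s Pt D i) ≤
        (t : ℝ) ^ D * (((D : ℝ) + 1) ^ 2 * Real.exp (2 * (D : ℝ) ^ β)) := by
      intro i hi
      obtain ⟨h1, h2, h3⟩ := hQi i (mem_Icc.mp hi).2
      rw [smul_eq_C_mul]
      calc l1Norm (C ((t : ℂ) ^ i) * Fpoly r s Pt D i)
          ≤ l1Norm (C ((t : ℂ) ^ i) : CX) * l1Norm (Fpoly r s Pt D i) := l1Norm_mul_le _ _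
        _ = (t : ℝ) ^ i * l1Norm (Fpoly r s Pt D i) := by
            rw [l1Norm_C, norm_pow, Complex.norm_natCast]
        _ ≤ (t : ℝ) ^ D * (((D : ℝ) + 1) ^ 2 * Real.exp (2 * (D : ℝ) ^ β)) := by
            rw [← h2]
            refine mul_le_mul ?_ ((l1Norm_map_le_of_isHomogeneous h1).trans
              (mul_le_mul_of_nonneg_left h3 (by positivity))) (l1Norm_nonneg _) (by positivity)
            rcases Nat.eq_zero_or_pos t with rfl | ht
            · rcases Nat.eq_zero_or_pos i with rfl | hi0
              · have := (mem_Icc.mp hi).1; omega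
              · simp [zero_pow hi0.ne']
            · exact pow_le_pow_right₀ (by exact_mod_cast ht) (mem_Icc.mp hi).2
    calc l1Norm (∑ i ∈ Icc 1 D, ((t : ℂ) ^ i) • Fpoly r s Pt D i)
        ≤ ∑ i ∈ Icc 1 D, l1Norm (((t : ℂ) ^ i) • Fpoly r s Pt D i) := l1Norm_sum_le _ _
      _ ≤ ∑ _i ∈ Icc 1 D, (t : ℝ) ^ D * (((D : ℝ) + 1) ^ 2 * Real.exp (2 * (D : ℝ) ^ β)) :=
          Finset.sum_le_sum hterm
      _ = D * ((t : ℝ) ^ D * (((D : ℝ) + 1) ^ 2 * Real.exp (2 * (D : ℝ) ^ β))) := by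
          rw [Finset.sum_const, Nat.card_Icc, nsmul_eq_mul]; push_cast; ring_nf
      _ = D * (t : ℝ) ^ D * (((D : ℝ) + 1) ^ 2 * Real.exp (2 * (D : ℝ) ^ β)) := by ring

end companion

/-! ### Heights of the common zeros -/

/-- A non-zero integer polynomial has length `≥ 1`. [folklore] -/
theorem one_le_sum_abs_coeff {τ : Type*} {F : MvPolynomial τ ℤ} (hF : F ≠ 0) :
    (1 : ℝ) ≤ ∑ m ∈ F.support, |((coeff m F : ℤ) : ℝ)| := by
  obtain ⟨m, hm⟩ := MvPolynomial.support_nonempty.mpr hF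
  have h1 : (1 : ℝ) ≤ |((coeff m F : ℤ) : ℝ)| := by
    have h := mem_support_iff.mp hm
    have : (1 : ℤ) ≤ |coeff m F| := Int.one_le_abs h
    exact_mod_cast this
  exact h1.trans (Finset.single_le_sum (f := fun m => |((coeff m F : ℤ) : ℝ)|)
    (fun _ _ => abs_nonneg _) hm)

namespace TauPkg

variable {D : ℕ} {Pt Q₀ : MvPolynomial (Fin 3) ℤ} (T : TauPkg D Pt Q₀)

/-- The length `𝓛(Φ(P̃, Q₀, ·))` of the integer polynomial `F₀`. [cite: Roy2013, §6] -/
def LZ : ℝ := ∑ m ∈ (royF D T.M₁ T.M₂ T.σ Pt Q₀).support,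
  |((coeff m (royF D T.M₁ T.M₂ T.σ Pt Q₀) : ℤ) : ℝ)|

/-- `Φ(P̃ ⊗ ℂ, Q₀ ⊗ ℂ, ·) ≠ 0`. [folklore] -/
theorem royF_complex_ne_zero :
    royF D T.M₁ T.M₂ T.σ (map (Int.castRingHom ℂ) Pt) (map (Int.castRingHom ℂ) Q₀) ≠ 0 := by
  rw [T.hFeq]
  refine mul_ne_zero (C_ne_zero.mpr T.hc) (Finset.prod_ne_zero_iff.mpr fun i _ => ?_)
  exact pow_ne_zero _ (Roy2013.evalForm_ne_zero (T.hα0 i))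

/-- `F₀ ≠ 0` over `ℤ`, and `1 ≤ 𝓛(F₀)`. [folklore] -/
theorem one_le_LZ : 1 ≤ T.LZ :=
  one_le_sum_abs_coeff (royF_int_ne_zero T.σ T.royF_complex_ne_zero)

/-- The finite set of all coordinates of the representatives. [folklore] -/
def coords : Finset ℂ := univ.image fun p : Fin T.m × Fin 3 => T.α p.1 p.2

/-- All coordinates are algebraic. [folklore] -/
theorem isAlgebraic_of_mem_coords {x : ℂ} (hx : x ∈ T.coords) : IsAlgebraic ℚ x := by
  obtain ⟨p, -, rfl⟩ := Finset.mem_image.mp hx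
  exact T.alg p.1 p.2

/-- The coordinates lie in the closure field of `coords`. [folklore] -/
theorem mem_closureField_coords (i : Fin T.m) (k : Fin 3) : T.α i k ∈ closureField T.coords :=
  mem_closureField (fun _ hx => T.isAlgebraic_of_mem_coords hx)
    (Finset.mem_image.mpr ⟨(i, k), Finset.mem_univ _, rfl⟩)

/-- **The induced zero configuration** over a field `K` containing the coordinates (the seat-B
`Roy2013.ZeroConfigK`, as `LevelPkg.cfg`). [cite: Roy2013, §6, proof of Prop. 6.4] -/
def cfg (K : IntermediateField ℚ ℂ) (hK : ∀ i k, T.α i k ∈ K) : Roy2013.ZeroConfigK K (Fin T.m) where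
  α := T.α
  piv := T.piv
  P := map (Int.castRingHom ℚ) Pt
  Q := map (Int.castRingHom ℚ) Q₀
  piv_one := T.piv_one
  piv_min := T.piv_min
  mem := hK
  zero i := by rw [toCX_map_int, toCX_map_int]; exact T.zero i
  cov β hβ hP hQ := by
    rw [toCX_map_int] at hP hQ
    exact T.cov β hβ hP hQ
  sep := T.sep

/-- The configuration has the representatives of the package. [folklore] -/
@[simp] theorem cfg_α (K : IntermediateField ℚ ℂ) (hK : ∀ i k, T.α i k ∈ K) : (T.cfg K hK).α = T.α := rfl

/-- **`∑ⱼ eⱼ h_abs(αⱼ) ≤ log 𝓛(Φ(P̃, Q₀, ·)) / D`** (Gelfond–Mahler on the linear factors, the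
seat-B `Roy2013.sum_mul_height_le_log_length_royF`, read with the absolute height).
[cite: NguyenRoy2016, §5, proof of Prop. 14 ("h(W) ≤ D log‖P‖ + D log‖Q‖ + O(D²)");
Roy2013, Prop. 2.2 (ii)] -/
theorem sum_mul_habs_le (hD : 1 ≤ D) :
    ∑ i, (T.e i : ℝ) * habs (Projectivization.mk ℂ (T.α i) (T.hα0 i)) ≤ Real.log T.LZ / D := by
  -- a number field containing all coordinates
  have hS : ∀ x ∈ T.coords, IsAlgebraic ℚ x := by
    intro x hx
    obtain ⟨p, -, rfl⟩ := Finset.mem_image.mp hx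
    exact T.alg p.1 p.2
  set K : IntermediateField ℚ ℂ := closureField T.coords with hKdef
  have hmem : ∀ i k, T.α i k ∈ K := fun i k =>
    mem_closureField hS (Finset.mem_image.mpr ⟨(i, k), Finset.mem_univ _, rfl⟩)
  let αK : Fin T.m → Fin 3 → K := fun i k => ⟨T.α i k, hmem i k⟩
  let ι₀ : K →+* ℂ := (algebraMap K ℂ : K →+* ℂ)
  have hK0 : ∀ i, αK i ≠ 0 := fun i h =>
    T.hα0 i (funext fun k => congrArg Subtype.val (congrFun h k))
  -- the heights of the points
  have hpt : ∀ i, habs (Projectivization.mk ℂ (T.α i) (T.hα0 i)) =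
      logHeight (αK i) / Module.finrank ℚ K := fun i => habs_mk (K := K) ι₀ (αK i) (T.hα0 i)
  -- Gelfond–Mahler
  have hGM := sum_mul_height_le_log_length_royF ι₀ T.σ Pt Q₀ hK0
    (royF_int_ne_zero T.σ T.royF_complex_ne_zero) (c := T.c) (e := T.e) T.hFeq
  have hfin : (0 : ℝ) < Module.finrank ℚ K := by exact_mod_cast Module.finrank_pos
  have hDpos : (0 : ℝ) < D := by exact_mod_cast hD
  simp_rw [hpt]
  have e1 : ∑ i, (T.e i : ℝ) * (logHeight (αK i) / Module.finrank ℚ K) =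
      (∑ i, (T.e i : ℝ) * (D * logHeight (αK i))) / (D * Module.finrank ℚ K) := by
    rw [Finset.sum_div]
    refine Finset.sum_congr rfl fun i _ => ?_
    field_simp
  rw [e1, div_le_div_iff₀ (by positivity) hDpos]
  calc (∑ i, (T.e i : ℝ) * (D * logHeight (αK i))) * D
      ≤ (Module.finrank ℚ K * Real.log T.LZ) * D :=
        mul_le_mul_of_nonneg_right hGM hDpos.le
    _ = Real.log T.LZ * (D * Module.finrank ℚ K) := by ring

/-- **The length of `Φ(P̃, Q₀, ·)`**: `log 𝓛 ≤ N² + N₀ log⁺‖P̃‖ + N₁ log⁺‖Q‖` with `N = #Mon(3D)`,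
`N₀ = #Mon(2D) ≥ N₁` — from the seat-B `Roy2013.l1Norm_royF_le` (`𝓛 ≤ N! ‖P‖^{N₀}‖Q‖^{N₁}`).
[cite: Roy2013, §6, proof of Prop. 6.4 ("‖F‖ ≤ N!‖P‖^N‖Q‖^N")] -/
theorem log_LZ_le {BP BQ : ℝ} (hBQ : 0 ≤ BQ)
    (hP : maxNorm (map (Int.castRingHom ℂ) Pt) ≤ Real.exp BP)
    (hQ : maxNorm (map (Int.castRingHom ℂ) Q₀) ≤ Real.exp BQ) :
    Real.log T.LZ ≤ (((3 * D + 2).choose 2 : ℕ) : ℝ) ^ 2 +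
      (((2 * D + 2).choose 2 : ℕ) : ℝ) * BP + (((2 * D + 2).choose 2 : ℕ) : ℝ) * BQ := by
  set N : ℕ := Fintype.card (PhiRow D) with hNdef
  set N₀ : ℕ := Fintype.card ↥(finsuppAntidiag (univ : Finset (Fin 3)) (2 * D)) with hN₀def
  set N₁ : ℕ := Fintype.card ↥T.M₁ with hN₁def
  have hN : N = (3 * D + 2).choose 2 := by
    rw [hNdef, Fintype.card_coe, Finset.card_finsuppAntidiag_nat_eq_choose]
    simp only [Finset.card_univ, Fintype.card_fin]
    rw [show 3 + 3 * D - 1 = 3 * D + 2 by omega]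
    exact Nat.choose_symm_add
  have hN₀ : N₀ = (2 * D + 2).choose 2 := by
    rw [hN₀def, Fintype.card_coe, Finset.card_finsuppAntidiag_nat_eq_choose]
    simp only [Finset.card_univ, Fintype.card_fin]
    rw [show 3 + 2 * D - 1 = 2 * D + 2 by omega]
    exact Nat.choose_symm_add
  have hN₁ : N₁ ≤ N₀ := by
    rw [hN₁def, hN₀def, Fintype.card_coe, Fintype.card_coe]
    refine Finset.card_le_card fun μ hμ => ?_
    rw [mem_finsuppAntidiag]
    refine ⟨?_, Finset.subset_univ _⟩
    rw [← Finsupp.degree_eq_sum]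
    exact T.hM₁ μ hμ
  -- `LZ = 𝓛(Φ(P̃ ⊗ ℂ, Q₀ ⊗ ℂ, ·)) ≤ N! ‖P‖^{N₀} ‖Q‖^{N₁}`
  have hLZ : T.LZ ≤ (N.factorial : ℝ) * (Real.exp BP ^ N₀ * Real.exp BQ ^ N₁) := by
    have h1 := l1Norm_royF_le T.σ (map (Int.castRingHom ℂ) Pt) (map (Int.castRingHom ℂ) Q₀)
    rw [← map_royF, l1Norm_map_intCast] at h1
    refine h1.trans (mul_le_mul_of_nonneg_left ?_ (by positivity))
    exact mul_le_mul (pow_le_pow_left₀ (maxNorm_nonneg _) hP _)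
      (pow_le_pow_left₀ (maxNorm_nonneg _) hQ _) (pow_nonneg (maxNorm_nonneg _) _) (by positivity)
  have hNpos : (1 : ℝ) ≤ N := by
    rw [hN]
    have : 1 ≤ (3 * D + 2).choose 2 := Nat.choose_pos (by omega)
    exact_mod_cast this
  have hfac : (N.factorial : ℝ) ≤ (N : ℝ) ^ N := by exact_mod_cast Nat.factorial_le_pow N
  have hlogN : Real.log N ≤ N := by
    have := Real.log_le_sub_one_of_pos (show (0 : ℝ) < N by linarith); linarith
  calc Real.log T.LZ ≤ Real.log ((N.factorial : ℝ) * (Real.exp BP ^ N₀ * Real.exp BQ ^ N₁)) :=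
        Real.log_le_log (by linarith [T.one_le_LZ]) hLZ
    _ = Real.log (N.factorial : ℝ) + (N₀ * BP + N₁ * BQ) := by
        rw [Real.log_mul (by positivity) (by positivity), Real.log_mul (by positivity) (by positivity),
          Real.log_pow, Real.log_pow, Real.log_exp, Real.log_exp]
    _ ≤ N * N + (N₀ * BP + N₀ * BQ) := by
        have hA : Real.log (N.factorial : ℝ) ≤ N * N :=
          calc Real.log (N.factorial : ℝ) ≤ Real.log ((N : ℝ) ^ N) :=
                Real.log_le_log (by exact_mod_cast Nat.factorial_pos N) hfac
            _ = N * Real.log N := Real.log_pow _ _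
            _ ≤ N * N := mul_le_mul_of_nonneg_left hlogN (by linarith)
        have hB : (N₁ : ℝ) * BQ ≤ N₀ * BQ :=
          mul_le_mul_of_nonneg_right (by exact_mod_cast hN₁) hBQ
        linarith
    _ = (((3 * D + 2).choose 2 : ℕ) : ℝ) ^ 2 +
          (((2 * D + 2).choose 2 : ℕ) : ℝ) * BP + (((2 * D + 2).choose 2 : ℕ) : ℝ) * BQ := by
        rw [hN, hN₀]; ring

end TauPkg

/-! ### `ZeroBounds` -/

section supplier

variable {ξ η : ℂ} {r s : ℚ} {σ₀ β ν : ℝ} {Pt : ℕ → MvPolynomial (Fin 3) ℤ}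

/-- `(n+2 choose 2) ≤ (n+2)²`. [folklore] -/
theorem choose_two_le_sq (n : ℕ) : (((n + 2).choose 2 : ℕ) : ℝ) ≤ ((n : ℝ) + 2) ^ 2 := by
  have := Nat.choose_le_pow (n + 2) 2
  exact_mod_cast this

/-- **The data of one level `D`**: the parameter `t` of the companion `Q = ∑ tⁱΦⁱP̃_D`, its
integer model `Q₀`, the package of `(P̃_D, Q₀)`, and the sizes of `P̃_D`, `Q₀`, `𝓛(Φ(P̃_D, Q₀, ·))`.
(A record; shown to be inhabited under `PropsAt`, `SuppAt`.)
[cite: NguyenRoy2016, §5, proofs of Propositions 14 and 15] -/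
structure LevelData (r s : ℚ) (β : ℝ) (Pt : ℕ → MvPolynomial (Fin 3) ℤ) (D : ℕ) where
  /-- the parameter of the companion -/
  t : ℕ
  /-- the integer model of the companion -/
  Q₀ : MvPolynomial (Fin 3) ℤ
  /-- the package of `(P̃_D, Q₀)` -/
  pkg : TauPkg D (Pt D) Q₀
  ht : t ≤ D ^ 2
  hQ₀map : map (Int.castRingHom ℂ) Q₀ = Qcomb r s Pt D t
  hPmax : maxNorm (map (Int.castRingHom ℂ) (Pt D)) ≤ Real.exp (2 * (D : ℝ) ^ β)
  hQmax : maxNorm (map (Int.castRingHom ℂ) Q₀) ≤ Real.exp (5 * (D : ℝ) ^ 2 + 2 * (D : ℝ) ^ β)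
  hlogLZ : Real.log pkg.LZ ≤ 705 * (D : ℝ) ^ 4 + 64 * ((D : ℝ) ^ 2 * (D : ℝ) ^ β)

/-- **The level data exist** (`D ≥ 1`, `PropsAt`, `SuppAt`, `D < 4⌊D^σ⌋`).
[cite: NguyenRoy2016, §5, proof of Proposition 14 (Lemma 13, `W = 𝒵(P, Q)`)] -/
theorem nonempty_levelData (hr : r ≠ 0) (hs : s ≠ 0) (hs1 : s ≠ 1) (hs2 : s ≠ -1)
    {D : ℕ} (hD1 : 1 ≤ D) (hD : PropsAt ξ η r s σ₀ β ν Pt D) (hSupp : SuppAt Pt D)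
    (hD4 : D < 4 * ⌊(D : ℝ) ^ σ₀⌋₊) : Nonempty (LevelData r s β Pt D) := by
  -- the complex form `P̃` and its companion `Q`
  set P : CX := map (Int.castRingHom ℂ) (Pt D) with hPdef
  have hPhom : P.IsHomogeneous D := hD.1.map _
  have hP0 : P ≠ 0 := fun h => hD.2.1 (MvPolynomial.map_injective _ (RingHom.injective_int _)
    (by rw [map_zero]; exact h))
  obtain ⟨hX0, hX2⟩ := not_dvd_of_suppAt hSupp
  obtain ⟨t, ht, hrel⟩ := exists_coprime_tau_combination_rat hPhom hP0 hX0 hX2 hr hs hs1 hs2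
  rw [← Qcomb_eq_sum_iterate] at hrel
  obtain ⟨Q₀, hQ₀hom, hQ₀map, hQl1⟩ := exists_int_companion hD hD4 t
  set Q : CX := Qcomb r s Pt D t with hQdef
  have hQhom : Q.IsHomogeneous D := isHomogeneous_Qcomb hD t
  have hPQ : ∀ f : CX, Q * f ∈ Ideal.span {P} → f ∈ Ideal.span {P} := by
    intro f hf
    rw [Ideal.mem_span_singleton] at hf ⊢
    exact hrel.dvd_of_dvd_mul_left hf
  have hQ0 : Q ≠ 0 := by
    intro h0
    rw [h0] at hrel
    have hu : IsUnit P := isRelPrime_zero_right.mp hrel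
    have h1 : P.totalDegree = 0 := by
      obtain ⟨u, hu'⟩ := hu
      have h2 := congrArg totalDegree (u.mul_inv)
      rw [totalDegree_mul_of_isDomain (Units.ne_zero u) (Units.ne_zero u⁻¹), totalDegree_one] at h2
      rw [← hu']; omega
    rw [hPhom.totalDegree hP0] at h1
    omega
  -- the package
  have hQhom' : (map (Int.castRingHom ℂ) Q₀).IsHomogeneous D := by rw [hQ₀map]; exact hQhom
  obtain ⟨T⟩ := nonempty_tauPkg hD1 (Pt := Pt D) (Q₀ := Q₀) hPhom hQhom' hP0
    (by rw [hQ₀map]; exact hQ0) (by rw [hQ₀map]; exact hPQ)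
  have hDr : (1 : ℝ) ≤ D := by exact_mod_cast hD1
  have hDpos : (0 : ℝ) < D := by linarith
  -- sizes of `P̃` and `Q`
  have hPmax : maxNorm (map (Int.castRingHom ℂ) (Pt D)) ≤ Real.exp (2 * (D : ℝ) ^ β) := by
    obtain ⟨⟨Qz, -, hQzmap, hQzht⟩, -⟩ := hD.2.2 0 (by omega)
    have hQz : Qz = Pt D := by
      apply int_model_unique
      rw [hQzmap, Fpoly]
      simp
    rw [← hQz]
    exact (maxNorm_map_le_mvPolyHeight Qz).trans hQzht
  have hQmax : maxNorm (map (Int.castRingHom ℂ) Q₀) ≤ Real.exp (5 * (D : ℝ) ^ 2 + 2 * (D : ℝ) ^ β) := by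
    rw [hQ₀map]
    refine (maxNorm_le_l1Norm _).trans (hQl1.trans ?_)
    -- `D t^D (D+1)² ≤ e^{5D²}` (from `x + 1 ≤ eˣ`)
    have ht1 : (t : ℝ) + 1 ≤ ((D : ℝ) + 1) ^ 2 := by
      have : (t : ℝ) ≤ (D : ℝ) ^ 2 := by exact_mod_cast ht
      nlinarith
    have hD1e : (D : ℝ) + 1 ≤ Real.exp D := Real.add_one_le_exp _
    have hDe : (D : ℝ) ≤ Real.exp D := by linarith
    have hD2e : ((D : ℝ) + 1) ^ 2 ≤ Real.exp (2 * D) := by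
      calc ((D : ℝ) + 1) ^ 2 ≤ (Real.exp D) ^ 2 := pow_le_pow_left₀ (by positivity) hD1e 2
        _ = Real.exp (2 * D) := by rw [← Real.exp_nat_mul]; norm_num
    have htD : (t : ℝ) ^ D ≤ Real.exp (2 * (D : ℝ) ^ 2) := by
      calc (t : ℝ) ^ D ≤ ((t : ℝ) + 1) ^ D := pow_le_pow_left₀ (by positivity) (by linarith) D
        _ ≤ (Real.exp (2 * D)) ^ D := pow_le_pow_left₀ (by positivity) (ht1.trans hD2e) D
        _ = Real.exp (2 * (D : ℝ) ^ 2) := by rw [← Real.exp_nat_mul]; ring_nf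
    have hD3 : (D : ℝ) * (((D : ℝ) + 1) ^ 2) ≤ Real.exp (3 * (D : ℝ) ^ 2) := by
      calc (D : ℝ) * (((D : ℝ) + 1) ^ 2) ≤ Real.exp D * Real.exp (2 * D) :=
            mul_le_mul hDe hD2e (by positivity) (by positivity)
        _ = Real.exp (3 * D) := by rw [← Real.exp_add]; ring_nf
        _ ≤ Real.exp (3 * (D : ℝ) ^ 2) := Real.exp_le_exp.mpr (by nlinarith)
    calc (D : ℝ) * (t : ℝ) ^ D * (((D : ℝ) + 1) ^ 2 * Real.exp (2 * (D : ℝ) ^ β))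
        = ((D : ℝ) * ((D : ℝ) + 1) ^ 2) * (t : ℝ) ^ D * Real.exp (2 * (D : ℝ) ^ β) := by ring
      _ ≤ Real.exp (3 * (D : ℝ) ^ 2) * Real.exp (2 * (D : ℝ) ^ 2) * Real.exp (2 * (D : ℝ) ^ β) := by
          gcongr
      _ = Real.exp (5 * (D : ℝ) ^ 2 + 2 * (D : ℝ) ^ β) := by
          rw [← Real.exp_add, ← Real.exp_add]; ring_nf
  have hlog := T.log_LZ_le (by positivity) hPmax hQmax
  -- bookkeeping: `log 𝓛 ≤ 705 D⁴ + 64 D² D^β`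
  have hN : (((3 * D + 2).choose 2 : ℕ) : ℝ) ≤ 25 * (D : ℝ) ^ 2 := by
    have := choose_two_le_sq (3 * D)
    push_cast at this
    nlinarith
  have hN₀ : (((2 * D + 2).choose 2 : ℕ) : ℝ) ≤ 16 * (D : ℝ) ^ 2 := by
    have := choose_two_le_sq (2 * D)
    push_cast at this
    nlinarith
  have hβ0 : (0 : ℝ) ≤ (D : ℝ) ^ β := by positivity
  have hN2 : (0 : ℝ) ≤ (((3 * D + 2).choose 2 : ℕ) : ℝ) := by positivity
  have hlog' : Real.log T.LZ ≤ 705 * (D : ℝ) ^ 4 + 64 * ((D : ℝ) ^ 2 * (D : ℝ) ^ β) := by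
    refine hlog.trans ?_
    have h1 : (((3 * D + 2).choose 2 : ℕ) : ℝ) ^ 2 ≤ (25 * (D : ℝ) ^ 2) ^ 2 :=
      pow_le_pow_left₀ hN2 hN 2
    have h2 : (((2 * D + 2).choose 2 : ℕ) : ℝ) * (2 * (D : ℝ) ^ β) ≤ 16 * (D : ℝ) ^ 2 * (2 * (D : ℝ) ^ β) :=
      mul_le_mul_of_nonneg_right hN₀ (by positivity)
    have h3 : (((2 * D + 2).choose 2 : ℕ) : ℝ) * (5 * (D : ℝ) ^ 2 + 2 * (D : ℝ) ^ β) ≤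
        16 * (D : ℝ) ^ 2 * (5 * (D : ℝ) ^ 2 + 2 * (D : ℝ) ^ β) :=
      mul_le_mul_of_nonneg_right hN₀ (by positivity)
    nlinarith
  exact ⟨⟨t, Q₀, T, ht, hQ₀map, hPmax, hQmax, hlog'⟩⟩

/-- **The arithmetic Bézout bound at level `D ≥ 1`** from the level data (`β ≥ 2`):
`ZeroBounds r s β Pt 800 D`. [cite: NguyenRoy2016, §5, proof of Proposition 14
("deg(W) ≤ D²", "h(W) ≤ 5D^{1+β}")] -/
theorem zeroBounds_of_levelData (hβ : 2 ≤ β) {D : ℕ} (hD1 : 1 ≤ D) (L : LevelData r s β Pt D) :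
    ZeroBounds r s β Pt 800 D := by
  set T := L.pkg with hT
  -- the finite set `W`
  let pt : Fin T.m → PPt := fun i => Projectivization.mk ℂ (T.α i) (T.hα0 i)
  have hinj : Function.Injective pt := by
    intro i j hij
    by_contra hne
    obtain ⟨a, ha⟩ := (Projectivization.mk_eq_mk_iff ℂ _ _ (T.hα0 i) (T.hα0 j)).mp hij
    exact T.sep j i (Ne.symm hne) ⟨(a : ℂ), by rw [← ha]; rfl⟩
  refine ⟨L.t, univ.image pt, ?_, ?_, ?_⟩
  · -- coverage
    intro a haP haQ
    have hcov := T.cov (nv a) (nv_ne_zero a) haP (by rw [L.hQ₀map]; exact haQ)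
    obtain ⟨i, c, hc⟩ := hcov
    have hc0 : c ≠ 0 := by
      rintro rfl
      exact nv_ne_zero a (by rw [hc, zero_smul])
    refine Finset.mem_image.mpr ⟨i, Finset.mem_univ _, ?_⟩
    rw [← mk_nv a]
    symm
    exact (Projectivization.mk_eq_mk_iff ℂ _ _ (nv_ne_zero a) (T.hα0 i)).mpr
      ⟨Units.mk0 c hc0, by rw [hc]; rfl⟩
  · -- `#W ≤ D²`
    have h1 : (univ.image pt).card ≤ T.m := by
      simpa using Finset.card_image_le (s := (univ : Finset (Fin T.m))) (f := pt)
    have h2 : ((univ.image pt).card : ℝ) ≤ T.m := by exact_mod_cast h1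
    have h3 : (T.m : ℝ) ≤ (D : ℝ) ^ 2 := by exact_mod_cast T.hm
    linarith
  · -- heights
    have hDr : (1 : ℝ) ≤ D := by exact_mod_cast hD1
    have hDpos : (0 : ℝ) < D := by linarith
    have hsum : ∑ a ∈ univ.image pt, habs a ≤ Real.log T.LZ / D := by
      rw [Finset.sum_image fun i _ j _ h => hinj h]
      refine le_trans (Finset.sum_le_sum fun i _ => ?_) (T.sum_mul_habs_le hD1)
      have h1 : (1 : ℝ) ≤ T.e i := by exact_mod_cast T.he1 i
      have h2 := habs_nonneg (pt i)
      nlinarith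
    have hDβ : (D : ℝ) ^ 3 ≤ (D : ℝ) ^ (1 + β) := by
      rw [show ((D : ℝ)) ^ 3 = (D : ℝ) ^ (3 : ℝ) by norm_cast]
      exact Real.rpow_le_rpow_of_exponent_le hDr (by linarith)
    have hD2β : (D : ℝ) * (D : ℝ) ^ β = (D : ℝ) ^ (1 + β) := by
      rw [Real.rpow_add hDpos, Real.rpow_one]
    calc ∑ a ∈ univ.image pt, habs a ≤ Real.log T.LZ / D := hsum
      _ ≤ (705 * (D : ℝ) ^ 4 + 64 * ((D : ℝ) ^ 2 * (D : ℝ) ^ β)) / D :=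
          div_le_div_of_nonneg_right L.hlogLZ hDpos.le
      _ = 705 * (D : ℝ) ^ 3 + 64 * ((D : ℝ) * (D : ℝ) ^ β) := by
          rw [div_eq_iff hDpos.ne']
          ring
      _ ≤ 705 * (D : ℝ) ^ (1 + β) + 64 * (D : ℝ) ^ (1 + β) := by rw [hD2β]; gcongr
      _ ≤ 800 * (D : ℝ) ^ (1 + β) := by
          have : (0 : ℝ) ≤ (D : ℝ) ^ (1 + β) := by positivity
          linarith

/-- **The arithmetic Bézout bound at level `D ≥ 1`** (under `PropsAt`, `SuppAt`, `D < 4⌊D^σ⌋`,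
`β ≥ 2`): `ZeroBounds r s β Pt 800 D`. [cite: NguyenRoy2016, §5, proof of Proposition 14
("deg(W) ≤ D²", "h(W) ≤ 5D^{1+β}")] -/
theorem zeroBounds_of_propsAt (hr : r ≠ 0) (hs : s ≠ 0) (hs1 : s ≠ 1) (hs2 : s ≠ -1)
    (hβ : 2 ≤ β) {D : ℕ} (hD1 : 1 ≤ D) (hD : PropsAt ξ η r s σ₀ β ν Pt D) (hSupp : SuppAt Pt D)
    (hD4 : D < 4 * ⌊(D : ℝ) ^ σ₀⌋₊) : ZeroBounds r s β Pt 800 D := by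
  obtain ⟨L⟩ := nonempty_levelData (ξ := ξ) (η := η) (ν := ν) hr hs hs1 hs2 hD1 hD hSupp hD4
  exact zeroBounds_of_levelData hβ hD1 L

/-- **The hypothesis `bezout` of `nguyenRoy2016_thm_1_of_zeroBounds_cor16`**: with the data of
Theorem 1 and a sequence `P̃_D` as in Proposition 4 (`PropsAt`, `SuppAt` from `D₀` on),
`ZeroBounds r s β Pt 800 D` holds for every `D ≥ D₀`.
[cite: NguyenRoy2016, §5, proof of Proposition 14] -/
theorem exists_zeroBounds (hr : r ≠ 0) (hs : s ≠ 0) (hs1 : s ≠ 1) (hs2 : s ≠ -1)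
    (hσ1 : 1 ≤ σ₀) (hβ : σ₀ + 1 < β) {D₀ : ℕ}
    (hPt : ∀ D : ℕ, D₀ ≤ D → PropsAt ξ η r s σ₀ β ν Pt D) (hSupp : ∀ D : ℕ, D₀ ≤ D → SuppAt Pt D) :
    ∃ Bz : ℝ, 0 ≤ Bz ∧ ∀ D : ℕ, D₀ ≤ D → ZeroBounds r s β Pt Bz D := by
  refine ⟨800, by norm_num, fun D hD => ?_⟩
  rcases Nat.eq_zero_or_pos D with rfl | hD1
  · -- `D = 0`: `P̃_0` is a non-zero constant, no common zeros
    refine ⟨0, ∅, fun a ha _ => ?_, by simp, by rw [Finset.sum_empty]; positivity⟩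
    exfalso
    have h0 := hPt 0 hD
    obtain ⟨hhom, hne, -⟩ := h0
    have hc : Pt 0 = C (coeff 0 (Pt 0)) :=
      totalDegree_eq_zero_iff_eq_C.mp (hhom.totalDegree hne)
    have hc0 : coeff 0 (Pt 0) ≠ 0 := fun h => hne (by rw [hc, h, C_0])
    rw [hc, map_C, eval_C, eq_intCast, Int.cast_eq_zero] at ha
    exact hc0 ha
  · have hD4 : D < 4 * ⌊(D : ℝ) ^ σ₀⌋₊ := by
      have := le_floor_rpow hσ1 D
      omega
    exact zeroBounds_of_propsAt hr hs hs1 hs2 (by linarith) hD1 (hPt D hD) (hSupp D hD) hD4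

end supplier

end NguyenRoy

end Literature.NumberTheory.Transcendental

end
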